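import Summits.MatrixMultiplication.MatrixMultiplication.Theorems.SaturationLadderPowerModulus
import HarnessLib

/-!
# Route `SaturationLadder` on Strassen's spectrum, VI: the cut IS a ladder of moduli of ONE function

decomp-mm lens 1 «grading / quantitative ladder», gen 44, kernel K44-L (chain file 6; files 1–5 =
`SaturationLadderThinRoof`, `SaturationLadderCornerGerm`, `SaturationLadderCornerModulus`, `SaturationLadderFaceModulus`,
`SaturationLadderPowerModulus`).  Def-free, sorry-free support beneath the deciding crux `SubexpSaturation`
(stmt-MatrixMultiplication-25909) of `route-MatrixMultiplication-SaturationLadder`; cut of record UNCHANGED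
(`closes (h₁ : SubexpSaturation) (h₂ : SubexpToPoly) (h₃ : PolyToFinite) (h₄ : TailDescentTwo) (h₅ : SquareFromTwo)`).

Notation: universal spectral point `φ`, `θ = specMMPoint K φ ∈ [0,1]³`, DARKNESS `d = θ₀+θ₁+θ₂−2`, HEIGHT `θ₁`,
DEPTH `ε₂ = 1−θ₂`.  Every rung of the route's ladder is a MODULUS OF CONTINUITY of the darkness `d` at the light
face `{ε₂ = 0}` of Strassen's universal spectrum, and every item of the cut is the lift from one modulus to the
next.  THE LADDER (top = summit; the bracketed name is the route item that lifts TO the rung from the one below):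

  rung                         law on every universal `φ`                      status
  corner-log `κ`, `κ > c₂`     `d·log(θ₁/ε₂) ≤ κθ₁` eventually                  PROVED (file 3; `c₂ = 1.0650…`)
  corner-log `κ* = 0`          the same for every `κ > 0`                       = `h₁ SubexpSaturation` (deciding)
  power `∃α ∈ (0,1)`           `d ≤ B·θ₁^{1−α}·ε₂^α`                            = `PolySaturation`   [`h₂ SubexpToPoly`]
  Lipschitz `∃k ≥ 2`           `d ≤ (k−1)·ε₂`                                   = `FiniteSaturation` [`h₃ PolyToFinite`]
  slope one                    `d ≤ ε₂`                                         = `ω(1,2,1) = 3`     [`h₄ TailDescentTwo`]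
  zero                         `d ≤ 0`                                          = `ω = 2`            [`h₅ SquareFromTwo`]
  — face branch (height-free): Hölder `2/7` (indeed `log 2/log 11`) `d ≤ 6ε₂^{2/7}`  PROVED (file 4); Hölder `∀α<1` =
  the top of route `FarEdgeDescent`'s rate dial (§3); Lipschitz as above.

* §1 the two PROVED ends in one statement (`ladderEnds`), and the rungs `Lipschitz / slope one / zero` in the
  darkness chart by name (`finiteSaturation_iff_lipschitz`, `doubleSquare_iff_slopeOne`, `summit_iff_darkFree`).
* §2 ★★ the rate–transport DIAL of lens 2 in Hölder coordinates (every field): for every `θ ≥ 0`,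
  `(∃ δ > θ: e(k) ≤ Ck^{−δ} ∀ integer k ≥ 1) ⟺ (∃ α ∈ (θ/(1+θ), 1): d ≤ Bε₂^α ∀φ)` (`rateBeyond_iff_holderBeyond`;
  Legendre exchange `α = δ/(1+δ)` of file 4).
* §3 ★ the cut's items as MODULUS LIFTS, by name: `h₂ ⟺` (corner law ∀κ ⟹ power law ∃α), `h₃ ⟺` (power law ∃α ⟹
  Lipschitz ∃k), `h₄ ⟺` (Lipschitz of slope `k−1 ≥ 2` ⟹ slope one), `h₅ ⟺` (slope one ⟹ zero); and the proved
  downward arrow `PolySaturation ⟹ SubexpSaturation` read through the moduli.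

Nothing here proves `ω = 2` or an open item; no definitions (gate rule D-0009).  [cite: Strassen1988, Thm. 3.8]
[cite: LottiRomani1983, Prop. 4.1; Thm. 1; Thm. 2] [cite: CoppersmithWinograd1990, §8] [cite: AlmanLi2026, Proposition 4.2]
[cite: AlmanDuanVassilevskaWilliamsXuXuZhou2025, §3.4]
-/

set_option linter.dupNamespace false

noncomputable section

open scoped BigOperators

namespace Summit.MatrixMultiplication.MatrixMultiplication.Theorems.SaturationLadderModulusLadder

open Literature.Computability.AlgebraicComplexity
open Summit.MatrixMultiplication.MatrixMultiplication.Theses.SaturationLadder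
open Summit.MatrixMultiplication.MatrixMultiplication.Theorems.SaturationLadderThinRoof
open Summit.MatrixMultiplication.MatrixMultiplication.Theorems.SaturationLadderCornerGerm
open Summit.MatrixMultiplication.MatrixMultiplication.Theorems.SaturationLadderCornerModulus
open Summit.MatrixMultiplication.MatrixMultiplication.Theorems.SaturationLadderFaceModulus
open Summit.MatrixMultiplication.MatrixMultiplication.Theorems.SaturationLadderPowerModulus

variable {K : Type} [Field K]

/-! ## §1 The proved ends and the integer rungs in the darkness chart -/

/-- **The two proved ends of the ladder, in one statement** (over `ℂ`): the corner-log modulus law at every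
`κ > c₂ = (5 log(5/4) + 3 log 2)/3` (file 3, from the Coppersmith–Winograd corner family), and the Hölder face law
`d ≤ 6·ε₂^{2/7}` (file 4, from the far-edge tower of rate `2/5`). [cite: CoppersmithWinograd1990, §8]
[cite: LottiRomani1983, Prop. 4.1] [cite: HuangPan1998, (2.8)] -/
theorem ladderEnds :
    (∀ κ : ℝ, (5 * Real.log (5 / 4) + 3 * Real.log 2) / 3 < κ → ∃ u₀ : ℝ, ∀ F : SpectralMap ℂ,
        IsUniversalSpectralPoint ℂ F → specMMPoint ℂ F 2 < 1 →
          u₀ ≤ Real.log (specMMPoint ℂ F 1 / (1 - specMMPoint ℂ F 2)) →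
            (specMMPoint ℂ F 0 + specMMPoint ℂ F 1 + specMMPoint ℂ F 2 - 2) *
                Real.log (specMMPoint ℂ F 1 / (1 - specMMPoint ℂ F 2)) ≤ κ * specMMPoint ℂ F 1) ∧
      ∀ F : SpectralMap ℂ, IsUniversalSpectralPoint ℂ F →
        specMMPoint ℂ F 0 + specMMPoint ℂ F 1 + specMMPoint ℂ F 2 - 2 ≤ 6 * (1 - specMMPoint ℂ F 2) ^ (2 / 7 : ℝ) :=
  ⟨fun κ hκ => modulus_above_classCeiling κ hκ, fun _ hF => holderFace_two_sevenths hF⟩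

/-- **The Lipschitz rung**: `FiniteSaturation ⟺ ∃ integer k ≥ 2 ∀φ: d ≤ (k−1)·ε₂` (file 2's face law of slope `k`,
moved to the darkness chart). [cite: Strassen1988, Thm. 3.8] [cite: LottiRomani1983, Thm. 1] -/
theorem finiteSaturation_iff_lipschitz :
    FiniteSaturation ↔ ∃ k : ℕ, 2 ≤ k ∧ ∀ F : SpectralMap ℂ, IsUniversalSpectralPoint ℂ F →
      specMMPoint ℂ F 0 + specMMPoint ℂ F 1 + specMMPoint ℂ F 2 - 2 ≤ ((k : ℝ) - 1) * (1 - specMMPoint ℂ F 2) := by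
  rw [finiteSaturation_iff_face]
  refine exists_congr fun k => and_congr Iff.rfl (forall₂_congr fun F _ => ?_)
  constructor <;> intro h <;> nlinarith

/-- **The slope-one rung**: `ω(1,2,1) = 3 ⟺ ∀φ: d ≤ ε₂`. [cite: Strassen1988, Thm. 3.8] -/
theorem doubleSquare_iff_slopeOne :
    omegaRect ℂ 1 2 1 = 3 ↔ ∀ F : SpectralMap ℂ, IsUniversalSpectralPoint ℂ F →
      specMMPoint ℂ F 0 + specMMPoint ℂ F 1 + specMMPoint ℂ F 2 - 2 ≤ 1 - specMMPoint ℂ F 2 := by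
  rw [doubleSquare_iff_face]
  refine forall₂_congr fun F _ => ?_
  constructor <;> intro h <;> linarith

/-- **The zero rung is the summit**: `ω = 2 ⟺ ∀φ: d ≤ 0` (file 2's `summit_iff_unitRoof` in the darkness chart; cf.
route `FarEdgeDescent`'s `omega_eq_two_iff_noDark`). [cite: Strassen1988, Thm. 3.8] -/
theorem summit_iff_darkFree :
    _root_.MatrixMultiplication ↔ ∀ F : SpectralMap ℂ, IsUniversalSpectralPoint ℂ F →
      specMMPoint ℂ F 0 + specMMPoint ℂ F 1 + specMMPoint ℂ F 2 - 2 ≤ 0 := by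
  rw [summit_iff_unitRoof]
  refine forall₂_congr fun F _ => ?_
  constructor <;> intro h <;> linarith

/-! ## §2 The rate–transport dial in Hölder coordinates (every field) -/

/-- ★★ **The dial `θ ↦ δ > θ` of route `FarEdgeDescent` is the dial `θ ↦ α > θ/(1+θ)` of Hölder face exponents**
(every field, every `θ ≥ 0`): `(∃ δ > θ ∃ C ∀ integer k ≥ 1: ω(1,k,1) − (k+1) ≤ C·k^{−δ}) ⟺
(∃ α ∈ (θ/(1+θ), 1) ∃ B > 0 ∀φ: θ₀+θ₁+θ₂−2 ≤ B·(1−θ₂)^α)` — the Legendre exchange `α = δ/(1+δ)` of file 4, dial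
position by dial position.  At `θ = 0` both sides are theorems (file 4's `exists_holderFace`; the far-edge tower);
the top of the dial (`∀θ`: every power rate ⟺ every Hölder exponent `α < 1`) is open on both sides. [cite: LottiRomani1983, Prop. 4.1] [cite: Strassen1988, Thm. 3.8] -/
theorem rateBeyond_iff_holderBeyond {θ : ℝ} (hθ : 0 ≤ θ) :
    (∃ δ C : ℝ, θ < δ ∧ ∀ k : ℕ, 1 ≤ k → omegaRect K 1 k 1 - (k + 1) ≤ C * (k : ℝ) ^ (-δ)) ↔
      ∃ α B : ℝ, θ / (1 + θ) < α ∧ α < 1 ∧ 0 < B ∧ ∀ F : SpectralMap K, IsUniversalSpectralPoint K F →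
        specMMPoint K F 0 + specMMPoint K F 1 + specMMPoint K F 2 - 2 ≤ B * (1 - specMMPoint K F 2) ^ α := by
  have h1θ : 0 < 1 + θ := by linarith
  constructor
  · rintro ⟨δ, C, hδ, h⟩
    have hδ0 : 0 < δ := lt_of_le_of_lt hθ hδ
    set C' : ℝ := max C 1 with hC'
    have hC'0 : 0 < C' := lt_of_lt_of_le one_pos (le_max_right _ _)
    have h' : ∀ k : ℕ, 1 ≤ k → omegaRect K 1 k 1 - (k + 1) ≤ C' * (k : ℝ) ^ (-δ) := fun k hk =>
      (h k hk).trans (mul_le_mul_of_nonneg_right (le_max_left _ _) (Real.rpow_nonneg (Nat.cast_nonneg k) _))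
    have hex := rateExponent_of_holderExponent hδ0
    refine ⟨δ / (1 + δ), 2 * C' ^ (1 / (1 + δ)), ?_, hex.2.2, by positivity, fun F hF =>
      holderFace_of_farRate_nat hC'0 hδ0 h' hF⟩
    have h1δ : 0 < 1 + δ := by linarith
    rw [div_lt_div_iff₀ h1θ h1δ]
    nlinarith
  · rintro ⟨α, B, hα, hα1, hB, h⟩
    have hα0 : 0 < α := lt_of_le_of_lt (by positivity) hα
    obtain ⟨δ, C, hδ, hδα, hC, hrate⟩ := farRate_nat_of_holderFace hB hα0 hα1 h
    refine ⟨δ, C, ?_, hrate⟩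
    have h1α : 0 < 1 - α := by linarith
    rw [hδα, lt_div_iff₀ h1α]
    rw [div_lt_iff₀ h1θ] at hα
    nlinarith

/-! ## §3 The cut's items are modulus lifts (by name, over `ℂ`) -/

/-- ★ **`h₂ = SubexpToPoly` is the lift corner-log-modulus ⟹ power-modulus**: `SubexpToPoly ⟺
((∀ κ > 0 ∃ u₀ ∀φ off the face with log(θ₁/ε₂) ≥ u₀: d·log(θ₁/ε₂) ≤ κθ₁) → ∃ α ∈ (0,1) ∃ B > 0 ∀φ: d ≤ Bθ₁^{1−α}ε₂^α)`.
[cite: Strassen1988, Thm. 3.8] [cite: AlmanDuanVassilevskaWilliamsXuXuZhou2025, §3.4] -/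
theorem subexpToPoly_iff_moduli :
    SubexpToPoly ↔
      ((∀ κ : ℝ, 0 < κ → ∃ u₀ : ℝ, ∀ F : SpectralMap ℂ, IsUniversalSpectralPoint ℂ F →
          specMMPoint ℂ F 2 < 1 → u₀ ≤ Real.log (specMMPoint ℂ F 1 / (1 - specMMPoint ℂ F 2)) →
            (specMMPoint ℂ F 0 + specMMPoint ℂ F 1 + specMMPoint ℂ F 2 - 2) *
                Real.log (specMMPoint ℂ F 1 / (1 - specMMPoint ℂ F 2)) ≤ κ * specMMPoint ℂ F 1) →
        ∃ α B : ℝ, 0 < α ∧ α < 1 ∧ 0 < B ∧ ∀ F : SpectralMap ℂ, IsUniversalSpectralPoint ℂ F →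
          specMMPoint ℂ F 0 + specMMPoint ℂ F 1 + specMMPoint ℂ F 2 - 2 ≤
            B * specMMPoint ℂ F 1 ^ (1 - α) * (1 - specMMPoint ℂ F 2) ^ α) := by
  have e : SubexpToPoly ↔ (SubexpSaturation → PolySaturation) := Iff.rfl
  rw [e, subexpSaturation_iff_modulus, polySaturation_iff_powerModulus]

/-- ★ **`h₃ = PolyToFinite` is the lift power-modulus ⟹ Lipschitz**: `PolyToFinite ⟺
((∃ α ∈ (0,1) ∃ B > 0 ∀φ: d ≤ Bθ₁^{1−α}ε₂^α) → ∃ integer k ≥ 2 ∀φ: d ≤ (k−1)·ε₂)` (exponent `α = 1`, height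
factor gone, integer slope). [cite: Strassen1988, Thm. 3.8] [cite: LottiRomani1983, Thm. 1] -/
theorem polyToFinite_iff_moduli :
    PolyToFinite ↔
      ((∃ α B : ℝ, 0 < α ∧ α < 1 ∧ 0 < B ∧ ∀ F : SpectralMap ℂ, IsUniversalSpectralPoint ℂ F →
          specMMPoint ℂ F 0 + specMMPoint ℂ F 1 + specMMPoint ℂ F 2 - 2 ≤
            B * specMMPoint ℂ F 1 ^ (1 - α) * (1 - specMMPoint ℂ F 2) ^ α) →
        ∃ k : ℕ, 2 ≤ k ∧ ∀ F : SpectralMap ℂ, IsUniversalSpectralPoint ℂ F →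
          specMMPoint ℂ F 0 + specMMPoint ℂ F 1 + specMMPoint ℂ F 2 - 2 ≤
            ((k : ℝ) - 1) * (1 - specMMPoint ℂ F 2)) := by
  have e : PolyToFinite ↔ (PolySaturation → FiniteSaturation) := Iff.rfl
  rw [e, polySaturation_iff_powerModulus, finiteSaturation_iff_lipschitz]

/-- **The ladder of moduli is monotone where it is proved to be**: power modulus (`PolySaturation`) ⟹ corner
modulus zero (`SubexpSaturation`, `h₁`) and ⟹ Hölder face law ∃α (PROVED anyway, file 4) — so in the cut
`h₁ ← Poly ← Finite ← E₂ ← S` every arrow to the right of `h₁` is an honest strengthening and `h₂, h₃` are the two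
converse lifts. [cite: Strassen1988, Thm. 3.8] -/
theorem subexpSaturation_of_polySaturation_viaModuli (h : PolySaturation) : SubexpSaturation := by
  obtain ⟨α, B, hα, hα1, hB, hlaw⟩ := polySaturation_iff_powerModulus.1 h
  exact subexpSaturation_of_powerModulus hB hα hlaw


/-- ★ **`h₄ = TailDescentTwo` is the lift Lipschitz-of-some-slope ⟹ slope one**: `TailDescentTwo ⟺
((∃ integer k ≥ 3 ∀φ: d ≤ (k−1)ε₂) → ∀φ: d ≤ ε₂)`. [cite: Strassen1988, Thm. 3.8] [cite: ChristandlLeGallLysikovZuiddam2020, Thm. 1.2] -/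
theorem tailDescentTwo_iff_moduli :
    TailDescentTwo ↔
      ((∃ k : ℕ, 3 ≤ k ∧ ∀ F : SpectralMap ℂ, IsUniversalSpectralPoint ℂ F →
          specMMPoint ℂ F 0 + specMMPoint ℂ F 1 + specMMPoint ℂ F 2 - 2 ≤ ((k : ℝ) - 1) * (1 - specMMPoint ℂ F 2)) →
        ∀ F : SpectralMap ℂ, IsUniversalSpectralPoint ℂ F →
          specMMPoint ℂ F 0 + specMMPoint ℂ F 1 + specMMPoint ℂ F 2 - 2 ≤ 1 - specMMPoint ℂ F 2) := by
  rw [tailDescentTwo_iff_faces]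
  refine imp_congr (exists_congr fun k => and_congr Iff.rfl (forall₂_congr fun F _ => ?_))
    (forall₂_congr fun F _ => ?_)
  · constructor <;> intro h <;> nlinarith
  · constructor <;> intro h <;> linarith

/-- ★ **`h₅ = SquareFromTwo` (residual) is the lift slope one ⟹ zero**: `SquareFromTwo ⟺ ((∀φ: d ≤ ε₂) → ∀φ: d ≤ 0)`.
[cite: Strassen1988, Thm. 3.8] [cite: CoppersmithWinograd1982, Cor. 3.3] -/
theorem squareFromTwo_iff_moduli :
    SquareFromTwo ↔
      ((∀ F : SpectralMap ℂ, IsUniversalSpectralPoint ℂ F →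
          specMMPoint ℂ F 0 + specMMPoint ℂ F 1 + specMMPoint ℂ F 2 - 2 ≤ 1 - specMMPoint ℂ F 2) →
        ∀ F : SpectralMap ℂ, IsUniversalSpectralPoint ℂ F →
          specMMPoint ℂ F 0 + specMMPoint ℂ F 1 + specMMPoint ℂ F 2 - 2 ≤ 0) := by
  have e : SquareFromTwo ↔ (omegaRect ℂ 1 2 1 = 3 → _root_.MatrixMultiplication) := Iff.rfl
  rw [e, doubleSquare_iff_slopeOne, summit_iff_darkFree]

end Summit.MatrixMultiplication.MatrixMultiplication.Theorems.SaturationLadderModulusLadder
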